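import Mathlib
import Literature.NumberTheory.Transcendental.AnalytificationImplicit
import Literature.ModelTheory.ExponentialFields.SemialgebraicComponents
import Literature.ModelTheory.ExponentialFields.SemialgebraicInterior
import Literature.NumberTheory.Transcendental.SemialgebraicMapsProofs
import Literature.NumberTheory.Transcendental.KZSemialgebraicComplex

/-!
# Route `ComplexOrientations`, support item `CauchyMove` (stmt-KontsevichZagierPeriods-11370):
# algebraic holomorphic germs are `ℚ`-semialgebraic — part 1 (polynomial algebra)

Helper file (prover-owned, `--supports CauchyMove`). The Cauchy move of the route needs the real
and imaginary parts of a holomorphic `g` on a disc, algebraic over `ℚ(t)` (`P(g(t), t) = 0`,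
`0 ≠ P ∈ ℚ[w, t]`), as `ℚ`-semialgebraic functions of `(Re t, Im t)`, so that `Re g`, `Im g` can
serve as Newton–Leibniz primitives of the Kontsevich–Zagier calculus (`KZCalculus.lean`). This
file supplies the algebraic preliminaries, with NO new definitions (the identification
`ℝ⁴ ≅ ℂ²`, `z ↦ (w, t) = (z₂ + i z₃, z₀ + i z₁)`, is local notation `rho4`, `cxW`, `cxT`, `cx`):

* real and imaginary parts of `ℚ`-polynomials on `ℂ²` are `ℚ`-polynomials on `ℝ⁴`
  (`exists_re_im_poly`), so their zero sets are `ℚ`-semialgebraic;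
* `derivative_finSuccEquiv` and consequences: `∂/∂w` versus `degreeOf 0` through
  `MvPolynomial.finSuccEquiv`;
* `exists_goodPoly`: **minimal-degree reduction** — if a non-zero `P ∈ ℚ[w, t]` vanishes on the
  graph of `g` over a non-empty open `U ⊆ ℂ`, some such `P` has `∂P/∂w (g t, t) ≢ 0` on `U`
  (strong induction on `degreeOf 0`; the `w`-free case is excluded by the identity principle for
  the entire function `t ↦ P(0, t)` and `MvPolynomial.funext`).

Sources: J. Bochnak, M. Coste, M.-F. Roy, *Real Algebraic Geometry* (1998), §2.2 and Ch. 8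
(Nash functions); M. Kontsevich, D. Zagier, *Periods* (2001), §1.1–1.2. Everything here is
elementary and fully proved ([folklore]).
-/

noncomputable section

open MvPolynomial Set Metric
open Literature.ModelTheory.ExponentialFields Literature.NumberTheory.Transcendental

namespace Summit.KontsevichZagierPeriods.ComplexOrientations.CauchyMoveAux


/-! ### Realification of `ℂ²` -/

/-- The argument coordinate `t = z₀ + i z₁` of `z ∈ ℝ⁴ ≅ ℂ²` (local notation). -/
local notation:max "cxT " z:max => (Complex.mk (z 0) (z 1))

/-- The value coordinate `w = z₂ + i z₃` of `z ∈ ℝ⁴ ≅ ℂ²` (local notation). -/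
local notation:max "cxW " z:max => (Complex.mk (z 2) (z 3))

/-- The complex point `(w, t) = (z₂ + i z₃, z₀ + i z₁) ∈ ℂ²` attached to `z ∈ ℝ⁴`: first the
"value" coordinate `w`, then the "argument" coordinate `t` (local notation). -/
local notation:max "rho4 " z:max => (![Complex.mk (z 2) (z 3), Complex.mk (z 0) (z 1)] : Fin 2 → ℂ)

/-- The complex number `x₀ + i x₁` attached to a point `x ∈ ℝ²` (local notation). -/
local notation:max "cx " x:max => (Complex.mk (x 0) (x 1))

/-- `z ↦ cxT z` is continuous. [folklore] -/
theorem continuous_cxT : Continuous fun z : Fin 4 → ℝ => cxT z := by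
  have : (fun z : Fin 4 → ℝ => cxT z) = fun z => Complex.equivRealProdCLM.symm (z 0, z 1) := by
    funext z; apply Complex.ext <;> simp
  rw [this]
  exact Complex.equivRealProdCLM.symm.continuous.comp
    ((continuous_apply 0).prodMk (continuous_apply 1))

/-- `z ↦ cxW z` is continuous. [folklore] -/
theorem continuous_cxW : Continuous fun z : Fin 4 → ℝ => cxW z := by
  have : (fun z : Fin 4 → ℝ => cxW z) = fun z => Complex.equivRealProdCLM.symm (z 2, z 3) := by
    funext z; apply Complex.ext <;> simp
  rw [this]
  exact Complex.equivRealProdCLM.symm.continuous.comp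
    ((continuous_apply 2).prodMk (continuous_apply 3))

/-- `z ↦ rho4 z` is continuous. [folklore] -/
theorem continuous_rho4 : Continuous fun z : Fin 4 → ℝ => rho4 z := by
  refine continuous_pi fun i => ?_
  fin_cases i
  · exact continuous_cxW
  · exact continuous_cxT

/-- Real and imaginary parts of a `ℚ`-polynomial on `ℂ²` are `ℚ`-polynomials on `ℝ⁴`. -/
theorem exists_re_im_poly (P : MvPolynomial (Fin 2) ℚ) :
    ∃ Qr Qi : MvPolynomial (Fin 4) ℚ, ∀ z : Fin 4 → ℝ,
      aeval (rho4 z) P = ((aeval z Qr : ℝ) : ℂ) + ((aeval z Qi : ℝ) : ℂ) * Complex.I := by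
  induction P using MvPolynomial.induction_on with
  | C a =>
    refine ⟨C a, 0, fun z => ?_⟩
    apply Complex.ext <;> simp
  | add p q hp hq =>
    obtain ⟨pr, pi, hp⟩ := hp
    obtain ⟨qr, qi, hq⟩ := hq
    refine ⟨pr + qr, pi + qi, fun z => ?_⟩
    rw [map_add, hp z, hq z]
    simp only [map_add]
    push_cast
    ring
  | mul_X p i hp =>
    obtain ⟨pr, pi, hp⟩ := hp
    -- real and imaginary parts of the coordinate `X i ∘ rho4`
    obtain ⟨xr, xi, hx⟩ : ∃ xr xi : MvPolynomial (Fin 4) ℚ, ∀ z : Fin 4 → ℝ,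
        rho4 z i = ((aeval z xr : ℝ) : ℂ) + ((aeval z xi : ℝ) : ℂ) * Complex.I := by
      fin_cases i
      · exact ⟨X 2, X 3, fun z => by apply Complex.ext <;> simp⟩
      · exact ⟨X 0, X 1, fun z => by apply Complex.ext <;> simp⟩
    refine ⟨pr * xr - pi * xi, pr * xi + pi * xr, fun z => ?_⟩
    rw [map_mul, aeval_X, hp z, hx z]
    simp only [map_add, map_sub, map_mul]
    push_cast
    ring_nf
    rw [Complex.I_sq]
    ring

/-- The zero set in `ℝ⁴` of a `ℚ`-polynomial on `ℂ²` is `ℚ`-semialgebraic. -/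
theorem isSemialgebraic_setOf_aeval_rho4_eq_zero (P : MvPolynomial (Fin 2) ℚ) :
    IsSemialgebraic ℚ {z : Fin 4 → ℝ | aeval (rho4 z) P = 0} := by
  obtain ⟨Qr, Qi, h⟩ := exists_re_im_poly P
  have : {z : Fin 4 → ℝ | aeval (rho4 z) P = 0} =
      {z | aeval z Qr = 0} ∩ {z | aeval z Qi = 0} := by
    ext z
    simp only [mem_setOf_eq, mem_inter_iff, h z, Complex.ext_iff]
    simp
  rw [this]
  exact (isSemialgebraic_setOf_eval_eq_zero _).inter (isSemialgebraic_setOf_eval_eq_zero _)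

/-- The non-vanishing set in `ℝ⁴` of a `ℚ`-polynomial on `ℂ²` is `ℚ`-semialgebraic. -/
theorem isSemialgebraic_setOf_aeval_rho4_ne_zero (P : MvPolynomial (Fin 2) ℚ) :
    IsSemialgebraic ℚ {z : Fin 4 → ℝ | aeval (rho4 z) P ≠ 0} :=
  (isSemialgebraic_setOf_aeval_rho4_eq_zero P).compl

/-- Real and imaginary parts of a `ℚ`-polynomial on `ℂ²` are `ℚ`-semialgebraic functions on `ℝ⁴`. -/
theorem re_im_aeval_rho4 {s : Set (Fin 4 → ℝ)} (hs : IsSemialgebraic ℚ s) (P : MvPolynomial (Fin 2) ℚ) :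
    IsSemialgebraicFunOn ℚ s (fun z => (aeval (rho4 z) P).re) ∧
      IsSemialgebraicFunOn ℚ s (fun z => (aeval (rho4 z) P).im) := by
  obtain ⟨Qr, Qi, h⟩ := exists_re_im_poly P
  refine ⟨(isSemialgebraicFunOn_aeval hs Qr).congr fun z _ => ?_,
    (isSemialgebraicFunOn_aeval hs Qi).congr fun z _ => ?_⟩
  · simp [h z]
  · simp [h z]


/-! ### Polynomial algebra in the first variable -/

section PolyAlg

variable {R : Type*} [CommRing R] {n : ℕ}

/-- `Polynomial.derivative ∘ finSuccEquiv = finSuccEquiv ∘ pderiv 0`. -/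
theorem derivative_finSuccEquiv (f : MvPolynomial (Fin (n + 1)) R) :
    Polynomial.derivative (finSuccEquiv R n f) = finSuccEquiv R n (pderiv 0 f) := by
  induction f using MvPolynomial.induction_on with
  | C a =>
    rw [pderiv_C, map_zero, finSuccEquiv_apply, eval₂Hom_C, RingHom.comp_apply,
      Polynomial.derivative_C]
  | add p q hp hq => simp only [map_add, hp, hq]
  | mul_X p i hp =>
    rw [map_mul, Polynomial.derivative_mul, hp, (pderiv 0).leibniz, smul_eq_mul, smul_eq_mul,
      map_add, map_mul, map_mul]
    refine Fin.cases ?_ (fun j => ?_) i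
    · rw [finSuccEquiv_X_zero, pderiv_X_self, Polynomial.derivative_X, map_one]
      ring
    · rw [finSuccEquiv_X_succ, Polynomial.derivative_C, pderiv_X_of_ne (Fin.succ_ne_zero j),
        map_zero]
      ring

/-- If `degreeOf 0 f = 0` the evaluation does not depend on the first variable. -/
theorem eval_cons_eq_of_degreeOf_eq_zero (f : MvPolynomial (Fin (n + 1)) R)
    (hf : degreeOf 0 f = 0) (s : Fin n → R) (y y' : R) :
    eval (Fin.cons y s) f = eval (Fin.cons y' s) f := by
  rw [eval_eq_eval_mv_eval', eval_eq_eval_mv_eval']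
  have hdeg : (finSuccEquiv R n f).natDegree = 0 := by rw [natDegree_finSuccEquiv, hf]
  rw [Polynomial.eq_C_of_natDegree_eq_zero hdeg]
  simp

/-- `degreeOf 0 f = 0` forces `pderiv 0 f = 0`. -/
theorem pderiv_eq_zero_of_degreeOf_eq_zero (f : MvPolynomial (Fin (n + 1)) R)
    (hf : degreeOf 0 f = 0) : pderiv 0 f = 0 := by
  apply (finSuccEquiv R n).injective
  rw [← derivative_finSuccEquiv, map_zero]
  exact Polynomial.derivative_of_natDegree_zero (by rw [natDegree_finSuccEquiv, hf])

/-- `pderiv 0 f = 0` forces `degreeOf 0 f = 0` in characteristic zero. -/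
theorem degreeOf_eq_zero_of_pderiv_eq_zero [IsDomain R] [CharZero R]
    (f : MvPolynomial (Fin (n + 1)) R) (hf : pderiv 0 f = 0) : degreeOf 0 f = 0 := by
  rw [← natDegree_finSuccEquiv, ← Polynomial.derivative_eq_zero, derivative_finSuccEquiv, hf,
    map_zero]

/-- `pderiv 0` lowers `degreeOf 0`. -/
theorem degreeOf_pderiv_lt (f : MvPolynomial (Fin (n + 1)) R) (hf : degreeOf 0 f ≠ 0) :
    degreeOf 0 (pderiv 0 f) < degreeOf 0 f := by
  rw [← natDegree_finSuccEquiv, ← natDegree_finSuccEquiv, ← derivative_finSuccEquiv]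
  exact Polynomial.natDegree_derivative_lt (by rwa [natDegree_finSuccEquiv])

/-- `degreeOf` is invariant under an injective change of coefficients. -/
theorem degreeOf_map_of_injective {S σ : Type*} [CommRing S] (i : σ) (p : MvPolynomial σ R)
    {f : R →+* S} (hf : Function.Injective f) : degreeOf i (map f p) = degreeOf i p := by
  classical
  rw [degreeOf_eq_sup, degreeOf_eq_sup, support_map_of_injective p hf]

end PolyAlg

/-- `aeval` into `ℂ` is `eval` of the base-changed polynomial. -/
theorem aeval_eq_eval_map {σ : Type*} (x : σ → ℂ) (P : MvPolynomial σ ℚ) :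
    aeval x P = eval x (map (algebraMap ℚ ℂ) P) := by
  rw [aeval_def, eval_map]

/-- A vector in `ℂ²` is determined by its two entries. -/
theorem vec2_eq (x : Fin 2 → ℂ) : x = ![x 0, x 1] := by
  ext i; fin_cases i <;> rfl

/-- **Minimal-degree reduction.** If some non-zero `P ∈ ℚ[w, t]` vanishes on the graph
`{(g t, t) | t ∈ U}` of a function over a non-empty open `U ⊆ ℂ`, then some `P` vanishing on the
graph has `∂P/∂w` NOT vanishing identically on the graph. -/
theorem exists_goodPoly {U : Set ℂ} (hU : IsOpen U) (hne : U.Nonempty) (g : ℂ → ℂ)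
    (hP : ∃ P : MvPolynomial (Fin 2) ℚ, P ≠ 0 ∧ ∀ t ∈ U, aeval ![g t, t] P = 0) :
    ∃ P : MvPolynomial (Fin 2) ℚ, (∀ t ∈ U, aeval ![g t, t] P = 0) ∧
      ∃ t₁ ∈ U, aeval ![g t₁, t₁] (pderiv 0 P) ≠ 0 := by
  suffices h : ∀ d, ∀ P : MvPolynomial (Fin 2) ℚ, P ≠ 0 → (∀ t ∈ U, aeval ![g t, t] P = 0) →
      degreeOf 0 P = d → ∃ Q : MvPolynomial (Fin 2) ℚ, (∀ t ∈ U, aeval ![g t, t] Q = 0) ∧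
        ∃ t₁ ∈ U, aeval ![g t₁, t₁] (pderiv 0 Q) ≠ 0 by
    obtain ⟨P, hP0, hPU⟩ := hP
    exact h _ P hP0 hPU rfl
  intro d
  induction d using Nat.strong_induction_on with
  | _ d ih =>
  intro P hP0 hPU hd
  by_cases hgood : ∃ t₁ ∈ U, aeval ![g t₁, t₁] (pderiv 0 P) ≠ 0
  · exact ⟨P, hPU, hgood⟩
  push Not at hgood
  by_cases hD : pderiv 0 P = 0
  · -- `P` does not involve `w`: it is a polynomial in `t` vanishing on the open set `U`
    exfalso
    have hdeg : degreeOf 0 P = 0 := degreeOf_eq_zero_of_pderiv_eq_zero P hD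
    set Pc : MvPolynomial (Fin 2) ℂ := map (algebraMap ℚ ℂ) P with hPc
    have hdegc : degreeOf 0 Pc = 0 := by
      rw [hPc, degreeOf_map_of_injective 0 P (algebraMap ℚ ℂ).injective, hdeg]
    have hfree : ∀ w t : ℂ, eval ![w, t] Pc = eval ![0, t] Pc := fun w t =>
      eval_cons_eq_of_degreeOf_eq_zero Pc hdegc ![t] w 0
    -- `H t = P(0, t)` is entire and vanishes on `U`, hence everywhere
    set H : ℂ → ℂ := fun t => aeval ![(0 : ℂ), t] P with hH
    have hHan : AnalyticOnNhd ℂ H univ := by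
      refine AnalyticOnNhd.aeval_mvPolynomial (fun i => ?_) P
      fin_cases i
      · simpa using analyticOnNhd_const
      · simpa using analyticOnNhd_id
    obtain ⟨z₀, hz₀⟩ := hne
    have hHU : H =ᶠ[nhds z₀] 0 := by
      filter_upwards [hU.mem_nhds hz₀] with t ht
      show aeval ![(0 : ℂ), t] P = 0
      rw [aeval_eq_eval_map, ← hfree (g t) t, ← aeval_eq_eval_map]
      exact hPU t ht
    have hH0 : EqOn H 0 univ :=
      hHan.eqOn_zero_of_preconnected_of_eventuallyEq_zero isPreconnected_univ (mem_univ z₀) hHU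
    have hPc0 : Pc = 0 := by
      apply MvPolynomial.funext
      intro x
      rw [vec2_eq x, hfree, map_zero]
      have := hH0 (mem_univ (x 1))
      simp only [hH, Pi.zero_apply] at this
      rwa [aeval_eq_eval_map] at this
    exact hP0 (map_injective (algebraMap ℚ ℂ) (algebraMap ℚ ℂ).injective (by simpa using hPc0))
  · have hd0 : degreeOf 0 P ≠ 0 := fun h0 => hD (pderiv_eq_zero_of_degreeOf_eq_zero P h0)
    have hlt : degreeOf 0 (pderiv 0 P) < d := hd ▸ degreeOf_pderiv_lt P hd0
    exact ih _ hlt (pderiv 0 P) hD hgood rfl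

end Summit.KontsevichZagierPeriods.ComplexOrientations.CauchyMoveAux
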